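/-
COR-CM (cell pub-hodgecm2, stage 2 of the Hodge ladder) — count-neutral KERNEL COMBINATORICS «the named composite cyclotomic fields, IV: degree 24 completed»
(seat prover-pub-hodgecm2-b23-g39-0, binder prover b23, gen 39; claim ABELIAN-DATUM D7, HOME/INBOX.md; blanket `CorCM/FaceCyclotomic*`).
Theorems only: D2 `exists_autDatum_cyclotomic_of_unitTable`, D4 `isLeast_card_faces_hgen_cyclotomic_of_unitTable_even` and gen 37's numeric
instances / orbit numerals (`Census/EvenSliceFaceTransportCounts{,B}.lean`, `Census/EvenSliceOrbitCount{,B}.lean`) BY NAME; unit tables by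
`decide +kernel`; no geometry, no named fact, nothing asserted; `Interfaces.lean` (C1), every E term, B01 and `Transposition/*` are untouched.
HONEST FRAMING (COORDINATOR RULING — HODGE FRAMING CORRECTION, 2026-08-21T11:55:35Z): `HC_CM` is NOT proved, here or anywhere in the
tree; every `HodgeConjectureFor` below is CONDITIONAL on face periods; no period is produced.
T5: n/a-class — the only Prop hypothesis binder displayed is INT2-GEN's period hypothesis on the produced face set; checker: self
(prover-pub-hodgecm2-b23-g39-0), 2026-08-22.
-/
import Summits.HodgeConjecture.CorCM.FaceAbelianExact
import Summits.HodgeConjecture.CorCM.Census.EvenSliceFaceTransportCounts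
import Summits.HodgeConjecture.CorCM.Census.EvenSliceFaceTransportCountsB
import Summits.HodgeConjecture.CorCM.Census.EvenSliceOrbitCount
import Summits.HodgeConjecture.CorCM.Census.EvenSliceOrbitCountB
import HarnessLib

/-!
# The named composite cyclotomic CM fields, IV: `ℚ(ζ₅₂), ℚ(ζ₅₆), ℚ(ζ₇₂), ℚ(ζ₈₄)` — every cyclotomic field of degree `≤ 24` is now in the kernel

With `CorCM/FaceCyclotomicComposite{,B,C}.lean` + `…CompositeExact{,B}.lean` (N = 15, 16, 20, 21, 24, 28, 32, 33, 35, 36, 39, 40, 44, 45, 48, 60) and the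
cyclic lane `CorCM/FaceCyclotomicFields{,B}.lean` / `CorCM/FaceCyclicBlockNumerals.lean` (N = p^k: 7, 9, 11, 13, 17, 19, 23, 25, 27, 29, 31, and every
cyclic degree `≤ 30`), the four fields below COMPLETE the list of cyclotomic fields `ℚ(ζ_N)` (N ≢ 2 mod 4) with `6 ≤ φ(N) ≤ 24`: each now has
its least number of generating rank-four faces as a kernel theorem with no hypothesis beyond `[IsCyclotomicExtension {N} ℚ K]`.
(The twisted non-cyclic abelian case — `−1` a square in a non-cyclic `(ℤ/N)ˣ`, first at `N = 65`, degree `48` — does not occur in this range.)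

| `N` | `[K:ℚ]` | why `−1 ∉ ((ℤ/N)ˣ)²` | `A ≅ Gal(K⁺/ℚ)` | `#OrbitsA A` | faces |
|---|---|---|---|---|---|
| 52 | 24 | `4 ∣ 52` | `ℤ/12` | 179 | ≤ 178 = exact |
| 56 | 24 | `4 ∣ 56` | `ℤ/2 × ℤ/6` | 189 | ≤ 188 = exact |
| 72 | 24 | `4 ∣ 72` | `ℤ/2 × ℤ/6` | 189 | ≤ 188 = exact |
| 84 | 24 | `4 ∣ 84` | `ℤ/2 × ℤ/6` | 189 | ≤ 188 = exact |

Per field: `exists_faceSet_cyclotomic_<N>` (a face set of at most `#OrbitsA A − 1` faces whose periods give HC of the slice — CONDITIONAL) and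
`isLeast_card_faces_hgen_cyclotomic_<N>` (EXACTLY that many generating faces, none fewer).  `HC_CM` is NOT proved; no period is produced.

References: [cite: Washington1997, Thm. 2.5]; [cite: Pohlmann1968, Thm. 1]; [cite: Milne1999LefschetzClasses, Thm. 3.2, Prop. 2.1];
[cite: Shimura1998, §6.2 Theorem 3 and §6.1 Corollary of Theorem 2 (pp. 41–43), §8.1 (p. 62)]; [cite: MumfordAV1970, §19 Thm. 1 and p. 169].
-/

noncomputable section

open CategoryTheory NumberField NumberField.ComplexEmbedding
open Literature.AlgebraicGeometry Literature.AlgebraicGeometry.Motives Literature.AlgebraicGeometry.HodgeTheory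
open Literature.AlgebraicGeometry.ComplexMultiplication Literature.AlgebraicGeometry.Milne1999
open Literature.NumberTheory.Automorphic
open Literature.NumberTheory.Automorphic.PicardCM
open Summit.HodgeConjecture.CorCM.Domination

namespace Summit.HodgeConjecture.CorCM.FaceAbelian

open Summit.HodgeConjecture.CorCM.Prior.AllgGroup.RfwfAllgGroup
open Summit.HodgeConjecture.CorCM.Census.OddDegreeParityLaw (OrbitsA)
open Summit.HodgeConjecture.CorCM.Census.EvenSliceOrbitCount

/-! ## `ℚ(ζ₅₂)` -/

/-- **`ℚ(ζ₅₂)` (degree `24`, `Aut ≅ (ℤ/52)ˣ`, `A ≅ ℤ/12`, `179` orbits): at most `178` faces** whose periods give HC of the slice — no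
datum hypothesis (`4 ∣ 52`; unit table = cosets `7^k·{±1} ↦ k`).  CONDITIONAL; `HC_CM` is NOT proved.
[cite: Washington1997, Thm. 2.5] [cite: Shimura1998, §6.2 Theorem 3 and §6.1 Corollary of Theorem 2 (pp. 41–43)]
[cite: Pohlmann1968, Thm. 1] [cite: Milne1999LefschetzClasses, Thm. 3.2 and Cor. 4.5] [cite: MumfordAV1970, §19 Thm. 1 and p. 169] -/
theorem exists_faceSet_cyclotomic_fiftyTwo (K : CMField) [IsCyclotomicExtension {52} ℚ (K : Type)] (σ₀ : (K : Type) →+* ℂ) :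
    ∃ 𝒮 : Finset (Face K), 𝒮.card ≤ 178 ∧
      ((∀ f ∈ 𝒮, ∃ ι₁ : K →+* ℂ, f.Admissible ι₁ ∧ ∃ (V : HermSpace3 K ι₁) (σ : K →+* ℂ),
        (Model.picardCMUniverse exists_isReal_hodgeModel_holds hodgePQ_independent_of_hodgeModel_holds
          BallQuotient.ballQuotientUniformised_holds cmAbelianVarietyRealised_holds).PeriodNV ι₁ V K f.psi σ) →
      ∀ {P B : AbelianVariety ℂ}, AbelianVariety.IsProductOf (fun B : AbelianVariety ℂ =>
        ∃ (E : Type) (_ : Field E) (_ : NumberField E) (_ : IsCMField E) (_ : E →+* (K : Type)) (Φ : CMType E)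
          (ι : 𝓞 E →+* End B) (θ : E →+* Module.End ℂ (complexBetti B.X 1)),
          IsCMTypeRealisation Φ B ι θ) P →
      AVDominatedBy B P → HodgeConjectureFor B.dim B.X) := by
  haveI : IsGalois ℚ (K : Type) := IsCyclotomicExtension.isGalois {52} ℚ (K : Type)
  obtain ⟨c, ε, hcσ, hε, hεc⟩ := exists_autDatum_cyclotomic_of_unitTable (K : Type) (N := 52) (A := ZMod 12) (by decide +kernel)
    (fun u : (ZMod 52)ˣ =>
      if (u : ZMod 52).val = 1 ∨ (u : ZMod 52).val = 51 then (0 : ZMod 12) else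
      if (u : ZMod 52).val = 7 ∨ (u : ZMod 52).val = 45 then (1 : ZMod 12) else
      if (u : ZMod 52).val = 3 ∨ (u : ZMod 52).val = 49 then (2 : ZMod 12) else
      if (u : ZMod 52).val = 21 ∨ (u : ZMod 52).val = 31 then (3 : ZMod 12) else
      if (u : ZMod 52).val = 9 ∨ (u : ZMod 52).val = 43 then (4 : ZMod 12) else
      if (u : ZMod 52).val = 11 ∨ (u : ZMod 52).val = 41 then (5 : ZMod 12) else
      if (u : ZMod 52).val = 25 ∨ (u : ZMod 52).val = 27 then (6 : ZMod 12) else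
      if (u : ZMod 52).val = 19 ∨ (u : ZMod 52).val = 33 then (7 : ZMod 12) else
      if (u : ZMod 52).val = 23 ∨ (u : ZMod 52).val = 29 then (8 : ZMod 12) else
      if (u : ZMod 52).val = 5 ∨ (u : ZMod 52).val = 47 then (9 : ZMod 12) else
      if (u : ZMod 52).val = 17 ∨ (u : ZMod 52).val = 35 then (10 : ZMod 12) else
      (11 : ZMod 12))
    (by decide +kernel) (by decide +kernel) (by decide +kernel) (by decide +kernel) σ₀
  exact exists_faceSet_evenSlice_zmod_twelve K σ₀ ε hε hcσ hεc

/-- **`ℚ(ζ₅₂)`: EXACTLY `178` generating faces, none fewer** (`β = 180`), for every base embedding — no datum hypothesis.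
[cite: Pohlmann1968, Thm. 1] [cite: Milne1999LefschetzClasses, Thm. 3.2] [cite: Washington1997, Thm. 2.5] -/
theorem isLeast_card_faces_hgen_cyclotomic_fiftyTwo (K : CMField) [IsCyclotomicExtension {52} ℚ (K : Type)]
    (σ₀ : (K : Type) →+* ℂ) :
    IsLeast {m : ℕ | ∃ 𝒮 : Finset (Face K), 𝒮.card = m ∧
      ∀ f : Face K, lefChar f.corner (fun _ => ({σ₀} : Finset ((K : Type) →+* ℂ))) ∈ AddSubgroup.closure
        {a : Asym K | ∃ g ∈ (𝒮 : Set (Face K)), ∃ σ : (K : Type) →+* ℂ, a = lefChar g.corner (fun _ => ({σ} : Finset ((K : Type) →+* ℂ)))}}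
      178 := by
  have h := isLeast_card_faces_hgen_cyclotomic_of_unitTable_even (F := (K : Type)) (N := 52) (A := ZMod 12) (by decide +kernel)
    (fun u : (ZMod 52)ˣ =>
      if (u : ZMod 52).val = 1 ∨ (u : ZMod 52).val = 51 then (0 : ZMod 12) else
      if (u : ZMod 52).val = 7 ∨ (u : ZMod 52).val = 45 then (1 : ZMod 12) else
      if (u : ZMod 52).val = 3 ∨ (u : ZMod 52).val = 49 then (2 : ZMod 12) else
      if (u : ZMod 52).val = 21 ∨ (u : ZMod 52).val = 31 then (3 : ZMod 12) else
      if (u : ZMod 52).val = 9 ∨ (u : ZMod 52).val = 43 then (4 : ZMod 12) else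
      if (u : ZMod 52).val = 11 ∨ (u : ZMod 52).val = 41 then (5 : ZMod 12) else
      if (u : ZMod 52).val = 25 ∨ (u : ZMod 52).val = 27 then (6 : ZMod 12) else
      if (u : ZMod 52).val = 19 ∨ (u : ZMod 52).val = 33 then (7 : ZMod 12) else
      if (u : ZMod 52).val = 23 ∨ (u : ZMod 52).val = 29 then (8 : ZMod 12) else
      if (u : ZMod 52).val = 5 ∨ (u : ZMod 52).val = 47 then (9 : ZMod 12) else
      if (u : ZMod 52).val = 17 ∨ (u : ZMod 52).val = 35 then (10 : ZMod 12) else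
      (11 : ZMod 12))
    (by decide +kernel) (by decide +kernel) (by decide +kernel) (by decide +kernel) (by simp only [ZMod.card]; decide) (by simp only [ZMod.card]; norm_num) σ₀
  rwa [← Nat.card_eq_fintype_card, card_orbitsA_zmod_twelve] at h

/-! ## `ℚ(ζ₅₆)` -/

/-- **`ℚ(ζ₅₆)` (degree `24`, `Aut ≅ (ℤ/56)ˣ`, `A ≅ ℤ/2 × ℤ/6`, `189` orbits): at most `188` faces** whose periods give HC of the slice — no
datum hypothesis (`4 ∣ 56`; unit table from the unit pair `(13, 3)` ↦ `ℤ/2 × ℤ/6`).  CONDITIONAL; `HC_CM` is NOT proved.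
[cite: Washington1997, Thm. 2.5] [cite: Shimura1998, §6.2 Theorem 3 and §6.1 Corollary of Theorem 2 (pp. 41–43)]
[cite: Pohlmann1968, Thm. 1] [cite: Milne1999LefschetzClasses, Thm. 3.2 and Cor. 4.5] [cite: MumfordAV1970, §19 Thm. 1 and p. 169] -/
theorem exists_faceSet_cyclotomic_fiftySix (K : CMField) [IsCyclotomicExtension {56} ℚ (K : Type)] (σ₀ : (K : Type) →+* ℂ) :
    ∃ 𝒮 : Finset (Face K), 𝒮.card ≤ 188 ∧
      ((∀ f ∈ 𝒮, ∃ ι₁ : K →+* ℂ, f.Admissible ι₁ ∧ ∃ (V : HermSpace3 K ι₁) (σ : K →+* ℂ),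
        (Model.picardCMUniverse exists_isReal_hodgeModel_holds hodgePQ_independent_of_hodgeModel_holds
          BallQuotient.ballQuotientUniformised_holds cmAbelianVarietyRealised_holds).PeriodNV ι₁ V K f.psi σ) →
      ∀ {P B : AbelianVariety ℂ}, AbelianVariety.IsProductOf (fun B : AbelianVariety ℂ =>
        ∃ (E : Type) (_ : Field E) (_ : NumberField E) (_ : IsCMField E) (_ : E →+* (K : Type)) (Φ : CMType E)
          (ι : 𝓞 E →+* End B) (θ : E →+* Module.End ℂ (complexBetti B.X 1)),
          IsCMTypeRealisation Φ B ι θ) P →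
      AVDominatedBy B P → HodgeConjectureFor B.dim B.X) := by
  haveI : IsGalois ℚ (K : Type) := IsCyclotomicExtension.isGalois {56} ℚ (K : Type)
  obtain ⟨c, ε, hcσ, hε, hεc⟩ := exists_autDatum_cyclotomic_of_unitTable (K : Type) (N := 56) (A := ZMod 2 × ZMod 6) (by decide +kernel)
    (fun u : (ZMod 56)ˣ =>
      if (u : ZMod 56).val = 1 ∨ (u : ZMod 56).val = 55 then ((0, 0) : ZMod 2 × ZMod 6) else
      if (u : ZMod 56).val = 3 ∨ (u : ZMod 56).val = 53 then ((0, 1) : ZMod 2 × ZMod 6) else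
      if (u : ZMod 56).val = 9 ∨ (u : ZMod 56).val = 47 then ((0, 2) : ZMod 2 × ZMod 6) else
      if (u : ZMod 56).val = 27 ∨ (u : ZMod 56).val = 29 then ((0, 3) : ZMod 2 × ZMod 6) else
      if (u : ZMod 56).val = 25 ∨ (u : ZMod 56).val = 31 then ((0, 4) : ZMod 2 × ZMod 6) else
      if (u : ZMod 56).val = 19 ∨ (u : ZMod 56).val = 37 then ((0, 5) : ZMod 2 × ZMod 6) else
      if (u : ZMod 56).val = 13 ∨ (u : ZMod 56).val = 43 then ((1, 0) : ZMod 2 × ZMod 6) else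
      if (u : ZMod 56).val = 17 ∨ (u : ZMod 56).val = 39 then ((1, 1) : ZMod 2 × ZMod 6) else
      if (u : ZMod 56).val = 5 ∨ (u : ZMod 56).val = 51 then ((1, 2) : ZMod 2 × ZMod 6) else
      if (u : ZMod 56).val = 15 ∨ (u : ZMod 56).val = 41 then ((1, 3) : ZMod 2 × ZMod 6) else
      if (u : ZMod 56).val = 11 ∨ (u : ZMod 56).val = 45 then ((1, 4) : ZMod 2 × ZMod 6) else
      ((1, 5) : ZMod 2 × ZMod 6))
    (by decide +kernel) (by decide +kernel) (by decide +kernel) (by decide +kernel) σ₀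
  exact exists_faceSet_evenSlice_zmod_two_six K σ₀ ε hε hcσ hεc

/-- **`ℚ(ζ₅₆)`: EXACTLY `188` generating faces, none fewer** (`β = 190`), for every base embedding — no datum hypothesis.
[cite: Pohlmann1968, Thm. 1] [cite: Milne1999LefschetzClasses, Thm. 3.2] [cite: Washington1997, Thm. 2.5] -/
theorem isLeast_card_faces_hgen_cyclotomic_fiftySix (K : CMField) [IsCyclotomicExtension {56} ℚ (K : Type)]
    (σ₀ : (K : Type) →+* ℂ) :
    IsLeast {m : ℕ | ∃ 𝒮 : Finset (Face K), 𝒮.card = m ∧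
      ∀ f : Face K, lefChar f.corner (fun _ => ({σ₀} : Finset ((K : Type) →+* ℂ))) ∈ AddSubgroup.closure
        {a : Asym K | ∃ g ∈ (𝒮 : Set (Face K)), ∃ σ : (K : Type) →+* ℂ, a = lefChar g.corner (fun _ => ({σ} : Finset ((K : Type) →+* ℂ)))}}
      188 := by
  have h := isLeast_card_faces_hgen_cyclotomic_of_unitTable_even (F := (K : Type)) (N := 56) (A := ZMod 2 × ZMod 6) (by decide +kernel)
    (fun u : (ZMod 56)ˣ =>
      if (u : ZMod 56).val = 1 ∨ (u : ZMod 56).val = 55 then ((0, 0) : ZMod 2 × ZMod 6) else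
      if (u : ZMod 56).val = 3 ∨ (u : ZMod 56).val = 53 then ((0, 1) : ZMod 2 × ZMod 6) else
      if (u : ZMod 56).val = 9 ∨ (u : ZMod 56).val = 47 then ((0, 2) : ZMod 2 × ZMod 6) else
      if (u : ZMod 56).val = 27 ∨ (u : ZMod 56).val = 29 then ((0, 3) : ZMod 2 × ZMod 6) else
      if (u : ZMod 56).val = 25 ∨ (u : ZMod 56).val = 31 then ((0, 4) : ZMod 2 × ZMod 6) else
      if (u : ZMod 56).val = 19 ∨ (u : ZMod 56).val = 37 then ((0, 5) : ZMod 2 × ZMod 6) else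
      if (u : ZMod 56).val = 13 ∨ (u : ZMod 56).val = 43 then ((1, 0) : ZMod 2 × ZMod 6) else
      if (u : ZMod 56).val = 17 ∨ (u : ZMod 56).val = 39 then ((1, 1) : ZMod 2 × ZMod 6) else
      if (u : ZMod 56).val = 5 ∨ (u : ZMod 56).val = 51 then ((1, 2) : ZMod 2 × ZMod 6) else
      if (u : ZMod 56).val = 15 ∨ (u : ZMod 56).val = 41 then ((1, 3) : ZMod 2 × ZMod 6) else
      if (u : ZMod 56).val = 11 ∨ (u : ZMod 56).val = 45 then ((1, 4) : ZMod 2 × ZMod 6) else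
      ((1, 5) : ZMod 2 × ZMod 6))
    (by decide +kernel) (by decide +kernel) (by decide +kernel) (by decide +kernel) (by simp only [Fintype.card_prod, ZMod.card]; decide) (by simp only [Fintype.card_prod, ZMod.card]; norm_num) σ₀
  rwa [← Nat.card_eq_fintype_card, card_orbitsA_zmod_two_six] at h

/-! ## `ℚ(ζ₇₂)` -/

/-- **`ℚ(ζ₇₂)` (degree `24`, `Aut ≅ (ℤ/72)ˣ`, `A ≅ ℤ/2 × ℤ/6`, `189` orbits): at most `188` faces** whose periods give HC of the slice — no
datum hypothesis (`4 ∣ 72`; unit table from the unit pair `(17, 5)` ↦ `ℤ/2 × ℤ/6`).  CONDITIONAL; `HC_CM` is NOT proved.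
[cite: Washington1997, Thm. 2.5] [cite: Shimura1998, §6.2 Theorem 3 and §6.1 Corollary of Theorem 2 (pp. 41–43)]
[cite: Pohlmann1968, Thm. 1] [cite: Milne1999LefschetzClasses, Thm. 3.2 and Cor. 4.5] [cite: MumfordAV1970, §19 Thm. 1 and p. 169] -/
theorem exists_faceSet_cyclotomic_seventyTwo (K : CMField) [IsCyclotomicExtension {72} ℚ (K : Type)] (σ₀ : (K : Type) →+* ℂ) :
    ∃ 𝒮 : Finset (Face K), 𝒮.card ≤ 188 ∧
      ((∀ f ∈ 𝒮, ∃ ι₁ : K →+* ℂ, f.Admissible ι₁ ∧ ∃ (V : HermSpace3 K ι₁) (σ : K →+* ℂ),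
        (Model.picardCMUniverse exists_isReal_hodgeModel_holds hodgePQ_independent_of_hodgeModel_holds
          BallQuotient.ballQuotientUniformised_holds cmAbelianVarietyRealised_holds).PeriodNV ι₁ V K f.psi σ) →
      ∀ {P B : AbelianVariety ℂ}, AbelianVariety.IsProductOf (fun B : AbelianVariety ℂ =>
        ∃ (E : Type) (_ : Field E) (_ : NumberField E) (_ : IsCMField E) (_ : E →+* (K : Type)) (Φ : CMType E)
          (ι : 𝓞 E →+* End B) (θ : E →+* Module.End ℂ (complexBetti B.X 1)),
          IsCMTypeRealisation Φ B ι θ) P →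
      AVDominatedBy B P → HodgeConjectureFor B.dim B.X) := by
  haveI : IsGalois ℚ (K : Type) := IsCyclotomicExtension.isGalois {72} ℚ (K : Type)
  obtain ⟨c, ε, hcσ, hε, hεc⟩ := exists_autDatum_cyclotomic_of_unitTable (K : Type) (N := 72) (A := ZMod 2 × ZMod 6) (by decide +kernel)
    (fun u : (ZMod 72)ˣ =>
      if (u : ZMod 72).val = 1 ∨ (u : ZMod 72).val = 71 then ((0, 0) : ZMod 2 × ZMod 6) else
      if (u : ZMod 72).val = 5 ∨ (u : ZMod 72).val = 67 then ((0, 1) : ZMod 2 × ZMod 6) else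
      if (u : ZMod 72).val = 25 ∨ (u : ZMod 72).val = 47 then ((0, 2) : ZMod 2 × ZMod 6) else
      if (u : ZMod 72).val = 19 ∨ (u : ZMod 72).val = 53 then ((0, 3) : ZMod 2 × ZMod 6) else
      if (u : ZMod 72).val = 23 ∨ (u : ZMod 72).val = 49 then ((0, 4) : ZMod 2 × ZMod 6) else
      if (u : ZMod 72).val = 29 ∨ (u : ZMod 72).val = 43 then ((0, 5) : ZMod 2 × ZMod 6) else
      if (u : ZMod 72).val = 17 ∨ (u : ZMod 72).val = 55 then ((1, 0) : ZMod 2 × ZMod 6) else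
      if (u : ZMod 72).val = 13 ∨ (u : ZMod 72).val = 59 then ((1, 1) : ZMod 2 × ZMod 6) else
      if (u : ZMod 72).val = 7 ∨ (u : ZMod 72).val = 65 then ((1, 2) : ZMod 2 × ZMod 6) else
      if (u : ZMod 72).val = 35 ∨ (u : ZMod 72).val = 37 then ((1, 3) : ZMod 2 × ZMod 6) else
      if (u : ZMod 72).val = 31 ∨ (u : ZMod 72).val = 41 then ((1, 4) : ZMod 2 × ZMod 6) else
      ((1, 5) : ZMod 2 × ZMod 6))
    (by decide +kernel) (by decide +kernel) (by decide +kernel) (by decide +kernel) σ₀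
  exact exists_faceSet_evenSlice_zmod_two_six K σ₀ ε hε hcσ hεc

/-- **`ℚ(ζ₇₂)`: EXACTLY `188` generating faces, none fewer** (`β = 190`), for every base embedding — no datum hypothesis.
[cite: Pohlmann1968, Thm. 1] [cite: Milne1999LefschetzClasses, Thm. 3.2] [cite: Washington1997, Thm. 2.5] -/
theorem isLeast_card_faces_hgen_cyclotomic_seventyTwo (K : CMField) [IsCyclotomicExtension {72} ℚ (K : Type)]
    (σ₀ : (K : Type) →+* ℂ) :
    IsLeast {m : ℕ | ∃ 𝒮 : Finset (Face K), 𝒮.card = m ∧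
      ∀ f : Face K, lefChar f.corner (fun _ => ({σ₀} : Finset ((K : Type) →+* ℂ))) ∈ AddSubgroup.closure
        {a : Asym K | ∃ g ∈ (𝒮 : Set (Face K)), ∃ σ : (K : Type) →+* ℂ, a = lefChar g.corner (fun _ => ({σ} : Finset ((K : Type) →+* ℂ)))}}
      188 := by
  have h := isLeast_card_faces_hgen_cyclotomic_of_unitTable_even (F := (K : Type)) (N := 72) (A := ZMod 2 × ZMod 6) (by decide +kernel)
    (fun u : (ZMod 72)ˣ =>
      if (u : ZMod 72).val = 1 ∨ (u : ZMod 72).val = 71 then ((0, 0) : ZMod 2 × ZMod 6) else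
      if (u : ZMod 72).val = 5 ∨ (u : ZMod 72).val = 67 then ((0, 1) : ZMod 2 × ZMod 6) else
      if (u : ZMod 72).val = 25 ∨ (u : ZMod 72).val = 47 then ((0, 2) : ZMod 2 × ZMod 6) else
      if (u : ZMod 72).val = 19 ∨ (u : ZMod 72).val = 53 then ((0, 3) : ZMod 2 × ZMod 6) else
      if (u : ZMod 72).val = 23 ∨ (u : ZMod 72).val = 49 then ((0, 4) : ZMod 2 × ZMod 6) else
      if (u : ZMod 72).val = 29 ∨ (u : ZMod 72).val = 43 then ((0, 5) : ZMod 2 × ZMod 6) else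
      if (u : ZMod 72).val = 17 ∨ (u : ZMod 72).val = 55 then ((1, 0) : ZMod 2 × ZMod 6) else
      if (u : ZMod 72).val = 13 ∨ (u : ZMod 72).val = 59 then ((1, 1) : ZMod 2 × ZMod 6) else
      if (u : ZMod 72).val = 7 ∨ (u : ZMod 72).val = 65 then ((1, 2) : ZMod 2 × ZMod 6) else
      if (u : ZMod 72).val = 35 ∨ (u : ZMod 72).val = 37 then ((1, 3) : ZMod 2 × ZMod 6) else
      if (u : ZMod 72).val = 31 ∨ (u : ZMod 72).val = 41 then ((1, 4) : ZMod 2 × ZMod 6) else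
      ((1, 5) : ZMod 2 × ZMod 6))
    (by decide +kernel) (by decide +kernel) (by decide +kernel) (by decide +kernel) (by simp only [Fintype.card_prod, ZMod.card]; decide) (by simp only [Fintype.card_prod, ZMod.card]; norm_num) σ₀
  rwa [← Nat.card_eq_fintype_card, card_orbitsA_zmod_two_six] at h

/-! ## `ℚ(ζ₈₄)` -/

/-- **`ℚ(ζ₈₄)` (degree `24`, `Aut ≅ (ℤ/84)ˣ`, `A ≅ ℤ/2 × ℤ/6`, `189` orbits): at most `188` faces** whose periods give HC of the slice — no
datum hypothesis (`4 ∣ 84`; unit table from the unit pair `(13, 5)` ↦ `ℤ/2 × ℤ/6`).  CONDITIONAL; `HC_CM` is NOT proved.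
[cite: Washington1997, Thm. 2.5] [cite: Shimura1998, §6.2 Theorem 3 and §6.1 Corollary of Theorem 2 (pp. 41–43)]
[cite: Pohlmann1968, Thm. 1] [cite: Milne1999LefschetzClasses, Thm. 3.2 and Cor. 4.5] [cite: MumfordAV1970, §19 Thm. 1 and p. 169] -/
theorem exists_faceSet_cyclotomic_eightyFour (K : CMField) [IsCyclotomicExtension {84} ℚ (K : Type)] (σ₀ : (K : Type) →+* ℂ) :
    ∃ 𝒮 : Finset (Face K), 𝒮.card ≤ 188 ∧
      ((∀ f ∈ 𝒮, ∃ ι₁ : K →+* ℂ, f.Admissible ι₁ ∧ ∃ (V : HermSpace3 K ι₁) (σ : K →+* ℂ),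
        (Model.picardCMUniverse exists_isReal_hodgeModel_holds hodgePQ_independent_of_hodgeModel_holds
          BallQuotient.ballQuotientUniformised_holds cmAbelianVarietyRealised_holds).PeriodNV ι₁ V K f.psi σ) →
      ∀ {P B : AbelianVariety ℂ}, AbelianVariety.IsProductOf (fun B : AbelianVariety ℂ =>
        ∃ (E : Type) (_ : Field E) (_ : NumberField E) (_ : IsCMField E) (_ : E →+* (K : Type)) (Φ : CMType E)
          (ι : 𝓞 E →+* End B) (θ : E →+* Module.End ℂ (complexBetti B.X 1)),
          IsCMTypeRealisation Φ B ι θ) P →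
      AVDominatedBy B P → HodgeConjectureFor B.dim B.X) := by
  haveI : IsGalois ℚ (K : Type) := IsCyclotomicExtension.isGalois {84} ℚ (K : Type)
  obtain ⟨c, ε, hcσ, hε, hεc⟩ := exists_autDatum_cyclotomic_of_unitTable (K : Type) (N := 84) (A := ZMod 2 × ZMod 6) (by decide +kernel)
    (fun u : (ZMod 84)ˣ =>
      if (u : ZMod 84).val = 1 ∨ (u : ZMod 84).val = 83 then ((0, 0) : ZMod 2 × ZMod 6) else
      if (u : ZMod 84).val = 5 ∨ (u : ZMod 84).val = 79 then ((0, 1) : ZMod 2 × ZMod 6) else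
      if (u : ZMod 84).val = 25 ∨ (u : ZMod 84).val = 59 then ((0, 2) : ZMod 2 × ZMod 6) else
      if (u : ZMod 84).val = 41 ∨ (u : ZMod 84).val = 43 then ((0, 3) : ZMod 2 × ZMod 6) else
      if (u : ZMod 84).val = 37 ∨ (u : ZMod 84).val = 47 then ((0, 4) : ZMod 2 × ZMod 6) else
      if (u : ZMod 84).val = 17 ∨ (u : ZMod 84).val = 67 then ((0, 5) : ZMod 2 × ZMod 6) else
      if (u : ZMod 84).val = 13 ∨ (u : ZMod 84).val = 71 then ((1, 0) : ZMod 2 × ZMod 6) else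
      if (u : ZMod 84).val = 19 ∨ (u : ZMod 84).val = 65 then ((1, 1) : ZMod 2 × ZMod 6) else
      if (u : ZMod 84).val = 11 ∨ (u : ZMod 84).val = 73 then ((1, 2) : ZMod 2 × ZMod 6) else
      if (u : ZMod 84).val = 29 ∨ (u : ZMod 84).val = 55 then ((1, 3) : ZMod 2 × ZMod 6) else
      if (u : ZMod 84).val = 23 ∨ (u : ZMod 84).val = 61 then ((1, 4) : ZMod 2 × ZMod 6) else
      ((1, 5) : ZMod 2 × ZMod 6))
    (by decide +kernel) (by decide +kernel) (by decide +kernel) (by decide +kernel) σ₀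
  exact exists_faceSet_evenSlice_zmod_two_six K σ₀ ε hε hcσ hεc

/-- **`ℚ(ζ₈₄)`: EXACTLY `188` generating faces, none fewer** (`β = 190`), for every base embedding — no datum hypothesis.
[cite: Pohlmann1968, Thm. 1] [cite: Milne1999LefschetzClasses, Thm. 3.2] [cite: Washington1997, Thm. 2.5] -/
theorem isLeast_card_faces_hgen_cyclotomic_eightyFour (K : CMField) [IsCyclotomicExtension {84} ℚ (K : Type)]
    (σ₀ : (K : Type) →+* ℂ) :
    IsLeast {m : ℕ | ∃ 𝒮 : Finset (Face K), 𝒮.card = m ∧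
      ∀ f : Face K, lefChar f.corner (fun _ => ({σ₀} : Finset ((K : Type) →+* ℂ))) ∈ AddSubgroup.closure
        {a : Asym K | ∃ g ∈ (𝒮 : Set (Face K)), ∃ σ : (K : Type) →+* ℂ, a = lefChar g.corner (fun _ => ({σ} : Finset ((K : Type) →+* ℂ)))}}
      188 := by
  have h := isLeast_card_faces_hgen_cyclotomic_of_unitTable_even (F := (K : Type)) (N := 84) (A := ZMod 2 × ZMod 6) (by decide +kernel)
    (fun u : (ZMod 84)ˣ =>
      if (u : ZMod 84).val = 1 ∨ (u : ZMod 84).val = 83 then ((0, 0) : ZMod 2 × ZMod 6) else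
      if (u : ZMod 84).val = 5 ∨ (u : ZMod 84).val = 79 then ((0, 1) : ZMod 2 × ZMod 6) else
      if (u : ZMod 84).val = 25 ∨ (u : ZMod 84).val = 59 then ((0, 2) : ZMod 2 × ZMod 6) else
      if (u : ZMod 84).val = 41 ∨ (u : ZMod 84).val = 43 then ((0, 3) : ZMod 2 × ZMod 6) else
      if (u : ZMod 84).val = 37 ∨ (u : ZMod 84).val = 47 then ((0, 4) : ZMod 2 × ZMod 6) else
      if (u : ZMod 84).val = 17 ∨ (u : ZMod 84).val = 67 then ((0, 5) : ZMod 2 × ZMod 6) else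
      if (u : ZMod 84).val = 13 ∨ (u : ZMod 84).val = 71 then ((1, 0) : ZMod 2 × ZMod 6) else
      if (u : ZMod 84).val = 19 ∨ (u : ZMod 84).val = 65 then ((1, 1) : ZMod 2 × ZMod 6) else
      if (u : ZMod 84).val = 11 ∨ (u : ZMod 84).val = 73 then ((1, 2) : ZMod 2 × ZMod 6) else
      if (u : ZMod 84).val = 29 ∨ (u : ZMod 84).val = 55 then ((1, 3) : ZMod 2 × ZMod 6) else
      if (u : ZMod 84).val = 23 ∨ (u : ZMod 84).val = 61 then ((1, 4) : ZMod 2 × ZMod 6) else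
      ((1, 5) : ZMod 2 × ZMod 6))
    (by decide +kernel) (by decide +kernel) (by decide +kernel) (by decide +kernel) (by simp only [Fintype.card_prod, ZMod.card]; decide) (by simp only [Fintype.card_prod, ZMod.card]; norm_num) σ₀
  rwa [← Nat.card_eq_fintype_card, card_orbitsA_zmod_two_six] at h

end Summit.HodgeConjecture.CorCM.FaceAbelian

end
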